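import Summits.KontsevichZagierPeriods.KontsevichZagierPeriods.Theorems.MzvKernelInKZ.Negative.Transfer

/-!
# `MzvKernelInKZ` (stmt-KontsevichZagierPeriods-3914): negative side — weight 5, where transcendence first enters

Companion of `Negative/Transfer.lean`.  **Weight 5: where transcendence first enters** (`d₅ = 2`).
Eight admissible words; inside the calculus duality identifies `311~41, 221~32, 212~23, 2111~5`,
so with base `{ζ(5), ζ(4,1)}` the spanning half is TWO typed memberships (the double shuffle
evaluations `2ζ(3,2) = ζ(5) − 6ζ(4,1)`, `2ζ(2,3) = ζ(5) + 4ζ(4,1)`: `cT32`, `cT23`), and the engine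
closes `WeightKernel 5` exactly when `ζ(5), ζ(4,1)` are `ℚ`-linearly independent
(`weightKernel_five_of`) — equivalently when `ζ(5), ζ(2)ζ(3)` are (`linearIndependent_five_iff`,
by Euler's `ζ(4,1) = 2ζ(5) − ζ(2)ζ(3)`), which is OPEN.  This is the precise sense of the crux's
why-might-fail "needs Zagier's conjecture": already its weight-5 rung is (two move chains) + (one
open irrationality).

Sources: D. Zagier (1994), §9; K. Ihara, M. Kaneko, D. Zagier, *Derivation and double shuffle
relations for multiple zeta values* (2006), §1 (finite double shuffle). -/

noncomputable section

namespace Summit.KontsevichZagierPeriods.MzvKernelInKZ.Negative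

open Set MeasureTheory MvPolynomial
open Literature.NumberTheory.Transcendental
open Summit.KontsevichZagierPeriods.KontsevichZagierPeriods.Theses.LinRedNormalForm (MzvKernelInKZ)

section WeightFive

variable {w : ℕ}

/-- The coefficient map of one word `q ↦ class of [Δ, q ω_ε]` (additive). [folklore] -/
def wcls (ε : Fin w → Bool) (hε : Adm ε) : ℚ →+ KZ.FormalRep ⧸ KZ.relations where
  toFun q := cls (KZ.of (wordRep ε q hε))
  map_zero' := cls_eq_zero_iff.mpr (of_wordRep_zero_mem_relations _ _)
  map_add' q₁ q₂ := by
    rw [← map_add, cls_eq_cls_iff, ← sub_sub]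
    exact of_wordRep_add _ _ _ _

/-- The class of `[Δ, q ω_ε]` is `wcls ε q` (definitional). [folklore] -/
theorem cls_of_wordRep (ε : Fin w → Bool) (q : ℚ) (hε : Adm ε) :
    cls (KZ.of (wordRep ε q hε)) = wcls ε hε q := rfl

/-- Rational rescaling by `c` sends the class of `[Δ, a ω_ε]` to `wcls ε (c a)`. [folklore] -/
theorem cls_scale_of_wordRep (c a : ℚ) (ε : Fin w → Bool) (hε : Adm ε) :
    cls (KZ.scale (c : ℝ) (isAlgebraic_ratCast c) (KZ.of (wordRep ε a hε))) = wcls ε hε (c * a) := by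
  rw [KZ.scale_of, ← cls_of_wordRep, cls_eq_cls_iff]
  exact of_sub_of_mem_relations_of_eqOn rfl fun t _ => by
    simp only [KZ.IntegralRep.integrand_constMul, wordRep_integrand, wordFun, Rat.cast_mul]
    ring

/-- Dual words have the same coefficient classes (duality is a relation). [folklore] -/
theorem wcls_dualWord (ε : Fin w → Bool) (hε : Adm ε) (q : ℚ) :
    wcls (dualWord ε) (adm_dualWord hε) q = wcls ε hε q := by
  rw [← cls_of_wordRep, ← cls_of_wordRep, eq_comm, cls_eq_cls_iff]
  exact duality_mem_relations ε q hε

/-- Coefficient maps of equal words are equal. [folklore] -/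
theorem wcls_congr {ε ε' : Fin w → Bool} (h : ε = ε') (hε : Adm ε) (hε' : Adm ε') :
    wcls ε hε = wcls ε' hε' := by
  subst h; rfl

/-- The admissible words of weight 5. [folklore] -/
def ω5 : Fin 5 → Bool := ![false, false, false, false, true]
/-- The word `00011` of `ζ(4,1)`. [folklore] -/
def ω41 : Fin 5 → Bool := ![false, false, false, true, true]
/-- The word `00101` of `ζ(3,2)`. [folklore] -/
def ω32 : Fin 5 → Bool := ![false, false, true, false, true]
/-- The word `01001` of `ζ(2,3)`. [folklore] -/
def ω23 : Fin 5 → Bool := ![false, true, false, false, true]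
/-- The word `00111` of `ζ(3,1,1)`. [folklore] -/
def ω311 : Fin 5 → Bool := ![false, false, true, true, true]
/-- The word `01011` of `ζ(2,2,1)`. [folklore] -/
def ω221 : Fin 5 → Bool := ![false, true, false, true, true]
/-- The word `01101` of `ζ(2,1,2)`. [folklore] -/
def ω212 : Fin 5 → Bool := ![false, true, true, false, true]
/-- The word `01111` of `ζ(2,1,1,1)`. [folklore] -/
def ω2111 : Fin 5 → Bool := ![false, true, true, true, true]

/-- `00001` is admissible. [folklore] -/
theorem adm_ω5 : Adm ω5 := by decide
/-- `00011` is admissible. [folklore] -/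
theorem adm_ω41 : Adm ω41 := by decide
/-- `00101` is admissible. [folklore] -/
theorem adm_ω32 : Adm ω32 := by decide
/-- `01001` is admissible. [folklore] -/
theorem adm_ω23 : Adm ω23 := by decide
/-- `00111` is admissible. [folklore] -/
theorem adm_ω311 : Adm ω311 := by decide
/-- `01011` is admissible. [folklore] -/
theorem adm_ω221 : Adm ω221 := by decide
/-- `01101` is admissible. [folklore] -/
theorem adm_ω212 : Adm ω212 := by decide
/-- `01111` is admissible. [folklore] -/
theorem adm_ω2111 : Adm ω2111 := by decide

/-- `(00011)† = 00111`. [folklore] -/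
theorem dualWord_ω41 : dualWord ω41 = ω311 := by decide
/-- `(00101)† = 01011`. [folklore] -/
theorem dualWord_ω32 : dualWord ω32 = ω221 := by decide
/-- `(01001)† = 01101`. [folklore] -/
theorem dualWord_ω23 : dualWord ω23 = ω212 := by decide
/-- `(00001)† = 01111`. [folklore] -/
theorem dualWord_ω5 : dualWord ω5 = ω2111 := by decide

/-- `value [Δ₅, ω₀₀₀₀₁] = ζ(5)`. [folklore] -/
theorem value_ω5 : (wordRep ω5 1 adm_ω5).value = multipleZeta [5] :=
  value_wordRep_eq_multipleZeta [5] (by decide) ω5 adm_ω5 (by decide)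

/-- `value [Δ₅, ω₀₀₀₁₁] = ζ(4,1)`. [folklore] -/
theorem value_ω41 : (wordRep ω41 1 adm_ω41).value = multipleZeta [4, 1] :=
  value_wordRep_eq_multipleZeta [4, 1] (by decide) ω41 adm_ω41 (by decide)

/-- `value [Δ₅, ω₀₀₁₀₁] = ζ(3,2)`. [folklore] -/
theorem value_ω32 : (wordRep ω32 1 adm_ω32).value = multipleZeta [3, 2] :=
  value_wordRep_eq_multipleZeta [3, 2] (by decide) ω32 adm_ω32 (by decide)

/-- `value [Δ₅, ω₀₁₀₀₁] = ζ(2,3)`. [folklore] -/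
theorem value_ω23 : (wordRep ω23 1 adm_ω23).value = multipleZeta [2, 3] :=
  value_wordRep_eq_multipleZeta [2, 3] (by decide) ω23 adm_ω23 (by decide)

/-- TYPED TARGET, weight 5: `[Δ₅, 2ω₃₂] − [Δ₅, ω₅] + [Δ₅, 6ω₄₁]` (value `2ζ(3,2) − ζ(5) + 6ζ(4,1) = 0`,
a double shuffle evaluation). [folklore] -/
def cT32 : KZ.FormalRep :=
  KZ.of (wordRep ω32 2 adm_ω32) - KZ.of (wordRep ω5 1 adm_ω5) + KZ.of (wordRep ω41 6 adm_ω41)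

/-- TYPED TARGET, weight 5: `[Δ₅, 2ω₂₃] − [Δ₅, ω₅] − [Δ₅, 4ω₄₁]` (value `2ζ(2,3) − ζ(5) − 4ζ(4,1) = 0`). [folklore] -/
def cT23 : KZ.FormalRep :=
  KZ.of (wordRep ω23 2 adm_ω23) - KZ.of (wordRep ω5 1 adm_ω5) - KZ.of (wordRep ω41 4 adm_ω41)

/-- `cT32` evaluates to `2ζ(3,2) − ζ(5) + 6ζ(4,1) = 0` (weight-5 double shuffle evaluation). [folklore] -/
theorem eval_cT32 : KZ.eval cT32 = 0 := by
  rw [cT32, map_add, map_sub, KZ.eval_of, KZ.eval_of, KZ.eval_of, value_wordRep ω32 2,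
    value_wordRep ω41 6, value_ω32, value_ω5, value_ω41, multipleZeta_three_two_eq,
    multipleZeta_four_one_eq]
  ring

/-- `cT23` evaluates to `2ζ(2,3) − ζ(5) − 4ζ(4,1) = 0` (weight-5 double shuffle evaluation). [folklore] -/
theorem eval_cT23 : KZ.eval cT23 = 0 := by
  rw [cT23, map_sub, map_sub, KZ.eval_of, KZ.eval_of, KZ.eval_of, value_wordRep ω23 2,
    value_wordRep ω41 4, value_ω23, value_ω5, value_ω41, multipleZeta_two_three_eq,
    multipleZeta_four_one_eq]
  ring

/-- `cT32` lies in the weight-5 closure. [folklore] -/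
theorem cT32_mem_closure : cT32 ∈ AddSubgroup.closure (genSetW 5) :=
  add_mem (sub_mem (AddSubgroup.subset_closure (genSetAdm_subset_genSetW (of_wordRep_mem_genSetAdm _ _ _)))
    (AddSubgroup.subset_closure (genSetAdm_subset_genSetW (of_wordRep_mem_genSetAdm _ _ _))))
    (AddSubgroup.subset_closure (genSetAdm_subset_genSetW (of_wordRep_mem_genSetAdm _ _ _)))

/-- `cT23` lies in the weight-5 closure. [folklore] -/
theorem cT23_mem_closure : cT23 ∈ AddSubgroup.closure (genSetW 5) :=
  sub_mem (sub_mem (AddSubgroup.subset_closure (genSetAdm_subset_genSetW (of_wordRep_mem_genSetAdm _ _ _)))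
    (AddSubgroup.subset_closure (genSetAdm_subset_genSetW (of_wordRep_mem_genSetAdm _ _ _))))
    (AddSubgroup.subset_closure (genSetAdm_subset_genSetW (of_wordRep_mem_genSetAdm _ _ _)))

/-- The calculus half of the weight-5 rung is forced by the rung (values from the tree's weight-5
double shuffle theorems). [folklore] -/
theorem targets5_of_weightKernel (h : WeightKernel 5) : cT32 ∈ KZ.relations ∧ cT23 ∈ KZ.relations :=
  ⟨h _ cT32_mem_closure eval_cT32, h _ cT23_mem_closure eval_cT23⟩

/-- The eight admissible words of weight `5`. [folklore] -/
theorem adm_five_cases {ε : Fin 5 → Bool} (hε : Adm ε) :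
    ε = ω5 ∨ ε = ω41 ∨ ε = ω32 ∨ ε = ω23 ∨ ε = ω311 ∨ ε = ω221 ∨ ε = ω212 ∨ ε = ω2111 := by
  obtain ⟨h0, h4⟩ := hε (by decide)
  have key : ∀ ε' : Fin 5 → Bool, ε' 0 = false → ε' 4 = true →
      ε' = ![false, ε' 1, ε' 2, ε' 3, true] := by
    intro ε' e0 e4
    funext i
    fin_cases i <;> simp [e0, e4]
  have hk := key ε (by simpa using h0) (by simpa using h4)
  rw [hk]
  cases ε 1 <;> cases ε 2 <;> cases ε 3 <;> decide

/-- In the quotient: the two targets, rescaled by `½`. [folklore] -/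
theorem wcls_ω32_of (h32 : cT32 ∈ KZ.relations) :
    wcls ω32 adm_ω32 1 = wcls ω5 adm_ω5 (1 / 2) + wcls ω41 adm_ω41 (-3) := by
  have h := cls_eq_zero_iff.mpr (KZ.scale_mem_relations ((1 / 2 : ℚ) : ℝ) (isAlgebraic_ratCast _) h32)
  rw [cT32, map_add, map_sub, map_add, map_sub, cls_scale_of_wordRep, cls_scale_of_wordRep,
    cls_scale_of_wordRep] at h
  norm_num at h
  rw [map_neg, ← sub_eq_zero, ← h]
  abel

/-- In the quotient: the target `cT23`, rescaled by `½`, expresses `[ω₀₁₀₀₁]` in the base `{ω₅, ω₄₁}`. [folklore] -/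
theorem wcls_ω23_of (h23 : cT23 ∈ KZ.relations) :
    wcls ω23 adm_ω23 1 = wcls ω5 adm_ω5 (1 / 2) + wcls ω41 adm_ω41 2 := by
  have h := cls_eq_zero_iff.mpr (KZ.scale_mem_relations ((1 / 2 : ℚ) : ℝ) (isAlgebraic_ratCast _) h23)
  rw [cT23, map_sub, map_sub, map_sub, map_sub, cls_scale_of_wordRep, cls_scale_of_wordRep,
    cls_scale_of_wordRep] at h
  norm_num at h
  rw [← sub_eq_zero, ← h]
  abel

/-- **THE WEIGHT-5 RUNG = two move chains + ONE open irrationality.** [folklore] -/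
theorem weightKernel_five_of
    (hind : LinearIndependent ℚ ![multipleZeta [5], multipleZeta [4, 1]])
    (h32 : cT32 ∈ KZ.relations) (h23 : cT23 ∈ KZ.relations) : WeightKernel 5 := by
  rw [weightKernel_iff_weightKernelAdm]
  have hB : ∀ j : Fin 2, Adm ((![ω5, ω41] : Fin 2 → (Fin 5 → Bool)) j) := by
    intro j; fin_cases j
    · exact adm_ω5
    · exact adm_ω41
  refine weightKernelAdm_of_basis ![ω5, ω41] hB ?_ fun ε hε => ?_
  · convert hind using 1
    funext j
    fin_cases j
    · exact value_ω5
    · exact value_ω41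
  · -- spanning, case by case, in the quotient
    have goal_iff : ∀ a : Fin 2 → ℚ,
        (KZ.of (wordRep ε 1 hε) - nf ![ω5, ω41] hB a ∈ KZ.relations ↔
          wcls ε hε 1 = wcls ω5 adm_ω5 (a 0) + wcls ω41 adm_ω41 (a 1)) := by
      intro a
      rw [← cls_eq_cls_iff, nf, Fin.sum_univ_two, map_add]
      rfl
    have e32 := wcls_ω32_of h32
    have e23 := wcls_ω23_of h23
    rcases adm_five_cases hε with rfl | rfl | rfl | rfl | rfl | rfl | rfl | rfl
    · exact ⟨![1, 0], (goal_iff _).mpr (by simp)⟩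
    · exact ⟨![0, 1], (goal_iff _).mpr (by simp)⟩
    · exact ⟨![1 / 2, -3], (goal_iff _).mpr (by simpa using e32)⟩
    · exact ⟨![1 / 2, 2], (goal_iff _).mpr (by simpa using e23)⟩
    · refine ⟨![0, 1], (goal_iff _).mpr ?_⟩
      rw [← wcls_congr dualWord_ω41 (adm_dualWord adm_ω41) hε, wcls_dualWord ω41 adm_ω41]
      simp
    · refine ⟨![1 / 2, -3], (goal_iff _).mpr ?_⟩
      rw [← wcls_congr dualWord_ω32 (adm_dualWord adm_ω32) hε, wcls_dualWord ω32 adm_ω32]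
      simpa using e32
    · refine ⟨![1 / 2, 2], (goal_iff _).mpr ?_⟩
      rw [← wcls_congr dualWord_ω23 (adm_dualWord adm_ω23) hε, wcls_dualWord ω23 adm_ω23]
      simpa using e23
    · refine ⟨![1, 0], (goal_iff _).mpr ?_⟩
      rw [← wcls_congr dualWord_ω5 (adm_dualWord adm_ω5) hε, wcls_dualWord ω5 adm_ω5]
      simp

/-- The independence hypothesis in the form usually quoted: by Euler's `ζ(4,1) = 2ζ(5) − ζ(2)ζ(3)`,
`ζ(5), ζ(4,1)` are independent iff `ζ(5), ζ(2)ζ(3)` are. [folklore] -/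
theorem linearIndependent_five_iff :
    LinearIndependent ℚ ![multipleZeta [5], multipleZeta [4, 1]] ↔
      LinearIndependent ℚ ![multipleZeta [5], multipleZeta [2] * multipleZeta [3]] := by
  rw [LinearIndependent.pair_iff, LinearIndependent.pair_iff]
  constructor
  · intro h s t hst
    -- s ζ5 + t ζ2ζ3 = 0, with ζ2ζ3 = 2ζ5 − ζ41
    have := h (s + 2 * t) (-t) (by
      rw [multipleZeta_four_one_eq]
      simp only [Rat.smul_def, Rat.cast_add, Rat.cast_mul, Rat.cast_neg, Rat.cast_ofNat] at hst ⊢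
      linarith)
    obtain ⟨h1, h2⟩ := this
    constructor <;> linarith
  · intro h s t hst
    have := h (s + 2 * t) (-t) (by
      rw [multipleZeta_four_one_eq] at hst
      simp only [Rat.smul_def, Rat.cast_add, Rat.cast_mul, Rat.cast_neg, Rat.cast_ofNat] at hst ⊢
      linarith)
    obtain ⟨h1, h2⟩ := this
    constructor <;> linarith

end WeightFive

end Summit.KontsevichZagierPeriods.MzvKernelInKZ.Negative
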